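import Summits.BirchSwinnertonDyer.BirchSwinnertonDyer.Theorems.KolyvaginDepthDoorSelmerCountReading
import Literature.NumberTheory.EllipticCurves.HeegnerPointsKolyvaginDepthDescentLeaves
import HarnessLib

/-!
# Route `KolyvaginDepthDoor`, crux `KolyvaginDepthSupply` (stmt-BirchSwinnertonDyer-21765) —
# the DOOR WITHOUT KOLYVAGIN'S STRUCTURE THEOREM: a non-zero class of depth `ν`, `ν + 1`
# independent points on `E(ℚ)` and `ν` on `E^{(d_K)}(ℚ)` give `corank_{ℤ_p} Ш(E/ℚ)[p^∞] = 0`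

Helper file (`--supports stmt-BirchSwinnertonDyer-21765 --as helper`); it closes nothing and BSD is
not proved by it.

Every door / depth-table row landed for this route so far (`…KolyvaginDepthSupplyDoor`,
`…DepthTableRows*`, `…DepthTableCruxAtCurve*`, `…DepthTableJLSRows*`) is conditional on the named
fact `hF = Kolyvagin1991_selmerCorank_of_kolyvaginClass_ne_zero` (Kolyvagin 1991, Thm. 4 in full:
EXACT coranks at the minimal depth; size XL, proof in LNM 1479, not held). This file replaces `hF`
by what the door actually needs — Kolyvagin's UPPER bound at level `p` — which is now a THEOREM of
the tree modulo the Euler-system leaves of Gross 1991 §§3–8: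

* `Literature…KolyvaginDescent.HypothesesDepth.card_sel_le_of_ne_zero` (file
  `HeegnerPointsKolyvaginDepthDescent`): Gross's §10 descent run at the minimal depth, pure
  algebra — one non-zero class of depth `ν₁` gives `#Sel(E/K)_p ≤ p^{2ν₁+1}`;
* `Literature…card_selmerGroup_le_of_ne_zero_of_leaves` (file
  `HeegnerPointsKolyvaginDepthDescentLeaves`): its instantiation on `H¹(K, E[p])`, from a family of
  classes `cl` with Gross's Props. 5.4 (2), 6.2 (hypotheses `hcl`), the named facts
  `Gross1991_prop_8_1_one` (Prop. 8.1 (1)) and `Gross1991_prop_8_2_finset` (the reciprocity law at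
  finitely many Kolyvagin places = the printed proof of Prop. 8.2), and McCallum's Cor. 3.2
  (a theorem of the tree);
* `rank_and_shaCorank_of_natCard_selmerGroup_baseChange_le` (file
  `KolyvaginDepthDoorSelmerCountReading`, unconditional): `#Sel_p(E/K) ≤ p^{a+b}` with
  `a ≤ rank E(ℚ)`, `b ≤ rank E^{(d_K)}(ℚ)` forces `t_p(E) = t_p(E^{(d_K)}) = 0`, `rank E = a`,
  `rank E^{(d_K)} = b`.

## Theorems

* `shaCorank_eq_zero_of_class_ne_zero_of_points_of_leaves` — **the door, both rank clauses at
  once**: `cl n ≠ 0` at depth `ν = #{q ∣ n}` and `a ≤ rank E(ℚ)`, `b ≤ rank E^{(d_K)}(ℚ)` with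
  `a + b = 2ν + 1` ⟹ `t_p(E) = 0`, `t_p(E^{(d_K)}) = 0`, `rank E(ℚ) = a`, `rank E^{(d_K)}(ℚ) = b`,
  `E(K)[p] = 0`, `Ш(E/K)[p] = 0`. (First clause of the crux: `(a, b) = (ν+1, ν)`; second clause:
  `(a, b) = (ν, ν+1)`.)
* `shaCorank_eq_zero_of_rank_two_of_class_prime_ne_zero_of_leaves` — **the rank-2 slice / the
  depth-table row certificate without `hF`**: ONE Kolyvagin prime `ℓ` with `cl ℓ ≠ 0`, two
  independent points on `E(ℚ)` and one point of infinite order on `E^{(d_K)}(ℚ)` give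
  `corank_{ℤ_p} Ш(E/ℚ)[p^∞] = 0`, `rank E(ℚ) = 2`, `rank E^{(d_K)}(ℚ) = 1`.

## Trust base, honestly

Named facts used: `Gross1991_prop_8_1_one`, `Gross1991_prop_8_2_finset` (local Tate duality at a
Kolyvagin prime and the reciprocity law for `Br(K)`; Gross 1991 §8, McCallum 1991 Prop. 2.2 /
Lemma 5.3 — standard, held, textbook material, no `_holds`). Hypotheses on the data: the class
family `cl` with Props. 5.4 (2) and 6.2 (for Kolyvagin's classes `c(n)` these are Gross 1991
§§3–6 / McCallum Lemma 4.3, Prop. 4.4 — for the crux's concrete `KolyvaginHeegnerData.kolyvaginClass`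
only Prop. 4.4 is vendored so far, `McCallum1991.prop44_localOrder_kolyvaginClass_mul_eq`), the
binders of the facts (a Heegner point `P` of level `N`, `¬ HasCM`, `d_K ∉ {−3, −4}`), and the
POINT certificates `a ≤ rank E(ℚ)`, `b ≤ rank E^{(d_K)}(ℚ)`. Compared with the hF-door: Kolyvagin's
Thm. 4 (XL, exact coranks + parity) is traded for two §8 leaves (size S–M each) and ONE extra
rational point on the twist; the Čebotarev input is a theorem; the algebra of the descent is a
theorem. Per-curve, not a class theorem.

References: [GrossLMS1991] §§5–10; [McCallumLMS1991] Prop. 2.2, Cor. 3.2, §4; [Kolyvagin1991MathAnn]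
Thm. 2.3; [SilvermanAEC2009] X.4.2, Ex. 10.16; [DokchitserDokchitserAnnals2010] Lemma 4.14.
-/

set_option linter.dupNamespace false

noncomputable section

open scoped Classical

namespace Summit.BirchSwinnertonDyer.BirchSwinnertonDyer.Theorems.KolyvaginDepthDoor

open Literature.NumberTheory.EllipticCurves WeierstrassCurve NumberField IsDedekindDomain

/-- **The door without Kolyvagin's structure theorem (both rank clauses).** `E/ℚ` elliptic without
CM, `K` imaginary quadratic with `d_K ∉ {−3, −4}` and the Heegner hypothesis for `N`, `P` a Heegner
point of level `N`, `p` an odd prime with `ρ̄_{E,p}` onto, `c` the complex conjugation of `K`;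
`cl : ℕ → H¹(K, E[p])` a family of classes with Gross's Prop. 5.4 (2) (sign `ε(−1)^{ν}`) and
Prop. 6.2 (unramified off `n`; at `λ_q ∣ n` ramified iff `cl(n/q)_{λ_q} ≠ 0`) at every square-free
product of Kolyvagin primes; the §8 leaves `Gross1991_prop_8_1_one`, `Gross1991_prop_8_2_finset`.
If `cl n ≠ 0` for a square-free product `n` of Kolyvagin primes with `ν` prime factors, and
`a ≤ rank E(ℚ)`, `b ≤ rank E^{(d_K)}(ℚ)` with `a + b = 2ν + 1`, then `corank_{ℤ_p} Ш(E/ℚ)[p^∞] = 0`,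
`corank_{ℤ_p} Ш(E^{(d_K)}/ℚ)[p^∞] = 0`, `rank E(ℚ) = a`, `rank E^{(d_K)}(ℚ) = b`, `#E(K)[p] = 1`
and `Ш(E/K)[p] = 0`: Kolyvagin's descent at the minimal depth gives `#Sel(E/K)_p ≤ p^{2ν+1}`
(`card_selmerGroup_le_of_ne_zero_of_leaves`) and the descent count reads it against the points
(`rank_and_shaCorank_of_natCard_selmerGroup_baseChange_le`). CONDITIONAL on `hB1`, `hB2`, `hcl`;
per-curve; BSD is not proved by it. [cite: Kolyvagin1991MathAnn, Thm. 2.3]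
[cite: GrossLMS1991, §10 with Props. 5.4, 6.2, 8.1, 8.2] [cite: SilvermanAEC2009, Thm X.4.2] -/
theorem shaCorank_eq_zero_of_class_ne_zero_of_points_of_leaves
    {N : ℕ} [NeZero N] (W : WeierstrassCurve ℚ) [W.IsElliptic] (K : Type) [Field K]
    [NumberField K] (hB1 : Gross1991_prop_8_1_one N W K) (hB2 : Gross1991_prop_8_2_finset N W K)
    (hE : ¬ W.HasCM) (hK : IsImaginaryQuadratic K)
    (hD : NumberField.discr K ≠ -3 ∧ NumberField.discr K ≠ -4) (hH : SatisfiesHeegnerHypothesis N K)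
    {P : (W.baseChange K).toAffine.Point} (hP : IsHeegnerPoint N W K P) (p : ℕ) [hp : Fact p.Prime]
    (hp2 : p ≠ 2) (hρ : W.HasSurjectiveModNGaloisRep p) (c : K ≃ₐ[ℚ] K) (hc : c ≠ 1)
    (hcc : c * c = 1) (ε : ℤ) (hε : ε = 1 ∨ ε = -1) (cl : ℕ → galH1Torsion (W.baseChange K) p)
    (hcl : ∀ n : ℕ, Squarefree n → (∀ q ∈ n.primeFactors, IsKolyvaginPrime N W K p q) →
      conjAct W c p (cl n) = (ε * (-1) ^ n.primeFactors.card) • cl n ∧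
      (∀ v : HeightOneSpectrum (𝓞 K), (n : 𝓞 K) ∉ v.asIdeal →
        cl n ∈ selmerLocalKer (W.baseChange K) (v.adicCompletion K) p) ∧
      (∀ w : InfinitePlace K, cl n ∈ selmerLocalKer (W.baseChange K) w.Completion p) ∧
      (∀ ℓ : ℕ, ℓ.Prime → ℓ ∣ n → ∀ v : HeightOneSpectrum (𝓞 K), (ℓ : 𝓞 K) ∈ v.asIdeal →
        (cl n ∈ selmerLocalKer (W.baseChange K) (v.adicCompletion K) p ↔
          cl (n / ℓ) ∈ (W.baseChange K).torsionLocalKer (v.adicCompletion K) p)))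
    {n : ℕ} (hn : Squarefree n) (hkn : ∀ q ∈ n.primeFactors, IsKolyvaginPrime N W K p q)
    (hne : cl n ≠ 0) (a b : ℕ) (hab : a + b = 2 * n.primeFactors.card + 1)
    (ha : a ≤ W.mordellWeilRank)
    (hb : b ≤ (W.quadraticTwist (NumberField.discr K : ℚ)).mordellWeilRank) :
    W.shaCorank p = 0 ∧ (W.quadraticTwist (NumberField.discr K : ℚ)).shaCorank p = 0 ∧
      W.mordellWeilRank = a ∧ (W.quadraticTwist (NumberField.discr K : ℚ)).mordellWeilRank = b ∧
      Nat.card ↥(AddSubgroup.torsionBy (W.baseChange K).toAffine.Point (p : ℤ)) = 1 ∧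
      (W.baseChange K).sha ⊓ AddSubgroup.torsionBy (W.baseChange K).galH1 (p : ℤ) = ⊥ := by
  obtain ⟨-, hcard, -⟩ := card_selmerGroup_le_of_ne_zero_of_leaves hB1 hB2 hE hK hD hH hP hp.out
    hp2 hρ c hc hcc ε hε cl hcl hn hkn hne
  rw [← hab] at hcard
  obtain ⟨hra, hrb, ht, hbot, -, hsha, hshaT⟩ :=
    rank_and_shaCorank_of_natCard_selmerGroup_baseChange_le W K hK.1 p a b hcard ha hb
  exact ⟨hsha, hshaT, hra, hrb, ht, hbot⟩

/-- **The rank-2 slice without `hF` — the depth-table row certificate from the leaves.** Same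
setting; ONE Kolyvagin prime `ℓ` (`IsKolyvaginPrime N W K p ℓ`) with `cl ℓ ≠ 0` — the bit a depth
table computes (Jetchev–Lauter–Stein: `P(ℓ) ∉ pE(K[ℓ])`) —, two independent points on `E(ℚ)` and
one point of infinite order on the twist `E^{(d_K)}(ℚ)` give `corank_{ℤ_p} Ш(E/ℚ)[p^∞] = 0`,
`rank E(ℚ) = 2`, `rank E^{(d_K)}(ℚ) = 1`, `corank Ш(E^{(d_K)}/ℚ)[p^∞] = 0`, `E(K)[p] = 0`,
`Ш(E/K)[p] = 0`. Compare `shaCorank_eq_zero_of_rank_two_of_kolyvaginClass_prime_ne_zero`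
(file `…KolyvaginDepthSupplyDoor`), which takes Kolyvagin's Thm. 4 (`hF`) instead of
(`hB1`, `hB2`, `hcl`, the twist point). CONDITIONAL on `hB1`, `hB2`, `hcl`; per-curve; BSD is not
proved by it. [cite: Kolyvagin1991MathAnn, Thm. 2.3] [cite: GrossLMS1991, §10]
[cite: JetchevLauterStein2009, §3.6 (arXiv:0707.0032)] -/
theorem shaCorank_eq_zero_of_rank_two_of_class_prime_ne_zero_of_leaves
    {N : ℕ} [NeZero N] (W : WeierstrassCurve ℚ) [W.IsElliptic] (K : Type) [Field K]
    [NumberField K] (hB1 : Gross1991_prop_8_1_one N W K) (hB2 : Gross1991_prop_8_2_finset N W K)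
    (hE : ¬ W.HasCM) (hK : IsImaginaryQuadratic K)
    (hD : NumberField.discr K ≠ -3 ∧ NumberField.discr K ≠ -4) (hH : SatisfiesHeegnerHypothesis N K)
    {P : (W.baseChange K).toAffine.Point} (hP : IsHeegnerPoint N W K P) (p : ℕ) [hp : Fact p.Prime]
    (hp2 : p ≠ 2) (hρ : W.HasSurjectiveModNGaloisRep p) (c : K ≃ₐ[ℚ] K) (hc : c ≠ 1)
    (hcc : c * c = 1) (ε : ℤ) (hε : ε = 1 ∨ ε = -1) (cl : ℕ → galH1Torsion (W.baseChange K) p)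
    (hcl : ∀ n : ℕ, Squarefree n → (∀ q ∈ n.primeFactors, IsKolyvaginPrime N W K p q) →
      conjAct W c p (cl n) = (ε * (-1) ^ n.primeFactors.card) • cl n ∧
      (∀ v : HeightOneSpectrum (𝓞 K), (n : 𝓞 K) ∉ v.asIdeal →
        cl n ∈ selmerLocalKer (W.baseChange K) (v.adicCompletion K) p) ∧
      (∀ w : InfinitePlace K, cl n ∈ selmerLocalKer (W.baseChange K) w.Completion p) ∧
      (∀ ℓ : ℕ, ℓ.Prime → ℓ ∣ n → ∀ v : HeightOneSpectrum (𝓞 K), (ℓ : 𝓞 K) ∈ v.asIdeal →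
        (cl n ∈ selmerLocalKer (W.baseChange K) (v.adicCompletion K) p ↔
          cl (n / ℓ) ∈ (W.baseChange K).torsionLocalKer (v.adicCompletion K) p)))
    {ℓ : ℕ} (hℓ : IsKolyvaginPrime N W K p ℓ) (hne : cl ℓ ≠ 0) (h2 : 2 ≤ W.mordellWeilRank)
    (h1 : 1 ≤ (W.quadraticTwist (NumberField.discr K : ℚ)).mordellWeilRank) :
    W.shaCorank p = 0 ∧ W.mordellWeilRank = 2 ∧
      (W.quadraticTwist (NumberField.discr K : ℚ)).mordellWeilRank = 1 ∧
      (W.quadraticTwist (NumberField.discr K : ℚ)).shaCorank p = 0 ∧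
      Nat.card ↥(AddSubgroup.torsionBy (W.baseChange K).toAffine.Point (p : ℤ)) = 1 ∧
      (W.baseChange K).sha ⊓ AddSubgroup.torsionBy (W.baseChange K).galH1 (p : ℤ) = ⊥ := by
  have hcard : ℓ.primeFactors.card = 1 := by rw [hℓ.prime.primeFactors, Finset.card_singleton]
  obtain ⟨hsha, hshaT, hra, hrb, ht, hbot⟩ :=
    shaCorank_eq_zero_of_class_ne_zero_of_points_of_leaves W K hB1 hB2 hE hK hD hH hP p hp2 hρ c hc
      hcc ε hε cl hcl hℓ.prime.squarefree (fun q hq ↦ by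
        rw [hℓ.prime.primeFactors, Finset.mem_singleton] at hq
        exact hq ▸ hℓ) hne 2 1 (by rw [hcard]) h2 h1
  exact ⟨hsha, hra, hrb, hshaT, ht, hbot⟩

end Summit.BirchSwinnertonDyer.BirchSwinnertonDyer.Theorems.KolyvaginDepthDoor

end
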